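import Mathlib.MeasureTheory.Group.FundamentalDomain
import Mathlib.MeasureTheory.Group.ModularCharacter
import Mathlib.MeasureTheory.Group.Prod
import HarnessLib

/-!
# A locally compact group with a finite-covolume lattice is unimodular

Topic `NumberTheory/Automorphic`; namespace `Literature.NumberTheory.Automorphic`. Abstract measure
theory (Mathlib only), written for the unipotent groups `N_n(𝔸_K) ⊇ N_n(K)` of the Whittaker
coefficients (`GlobalWhittakerCoefficient`, `WhittakerCoeffLocalDatum`): the equivariance
`W_φ(u₀ g) = ψ(u₀) W_φ(g)` proved there needs a **right**-invariant Haar measure on `N_n(𝔸_K)`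
(hypothesis `[IsMulRightInvariant ν]`), i.e. the unimodularity of `N_n(𝔸_K)`. Rather than through
nilpotency, we obtain it from the cocompact discrete subgroup `N_n(K)`:

**Theorem** (`isMulRightInvariant_of_isFundamentalDomain`). Let `G` be a locally compact group,
`μ` an inner regular left Haar measure, and `Γ ≤ G` a countable subgroup admitting a fundamental
domain `𝓕` (for left multiplication) with `0 < μ(𝓕) < ∞`. Then `μ` is right invariant (`G` is
unimodular).

*Proof.* For `g ∈ G` the right translate `𝓕 g` is again a fundamental domain of `Γ` (left and right
multiplications commute; right translations quasi-preserve a left Haar measure), so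
`μ(𝓕 g) = μ(𝓕)` (all fundamental domains have the same measure). On the other hand
`μ(𝓕 g) = (map (· g⁻¹) μ)(𝓕) = Δ(g⁻¹) μ(𝓕)` with `Δ` the modular function
(`map_right_mul_eq_modularCharacterFun_smul`). Hence `Δ ≡ 1`, i.e. `map (· g) μ = μ` for all `g`.
This is the classical remark that a group carrying a lattice is unimodular (Raghunathan,
*Discrete subgroups of Lie groups* (1972), Ch. I, Remark 1.9; Bekka–de la Harpe–Valette,
*Kazhdan's property (T)*, Prop. B.2.2 (ii)); we know no Mathlib statement of it
(`lean search 'IsMulRightInvariant.*FundamentalDomain|unimodular'`), so it is tagged folklore.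

* `isFundamentalDomain_image_mul_right` — right translates of fundamental domains;
* `measure_image_mul_right_eq_of_isFundamentalDomain` — `μ(𝓕 g) = μ(𝓕)`;
* `modularCharacterFun_eq_one_of_isFundamentalDomain` — `Δ ≡ 1`;
* `isMulRightInvariant_of_isFundamentalDomain` — the theorem.
-/

noncomputable section

open MeasureTheory Measure Set
open scoped ENNReal NNReal Pointwise

namespace Literature.NumberTheory.Automorphic

variable {G : Type*} [Group G] [TopologicalSpace G] [IsTopologicalGroup G] [MeasurableSpace G]
  [BorelSpace G] (Γ : Subgroup G) (μ : Measure G)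

/-- **Right translates of fundamental domains.** If `𝓕` is a fundamental domain for the left
multiplication action of a subgroup `Γ` and `μ` is left invariant, then so is `𝓕 g` for every
`g ∈ G` (left and right multiplication commute; `· g⁻¹` quasi-preserves `μ`,
Mathlib `quasiMeasurePreserving_mul_right`). [folklore] -/
theorem isFundamentalDomain_image_mul_right [SecondCountableTopology G] [SFinite μ]
    [μ.IsMulLeftInvariant] {𝓕 : Set G} (h𝓕 : IsFundamentalDomain Γ 𝓕 μ) (g : G) :
    IsFundamentalDomain Γ ((· * g) '' 𝓕) μ := by
  have hq : QuasiMeasurePreserving (Equiv.mulRight g).symm μ μ :=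
    quasiMeasurePreserving_mul_right μ g⁻¹
  have h := h𝓕.image_of_equiv (Equiv.mulRight g) hq (Equiv.refl _) fun γ x => ?_
  · simpa only [Equiv.coe_mulRight] using h
  · show (γ • x) * g = γ • (x * g)
    exact mul_assoc _ _ _

/-- **All right translates of a fundamental domain have the same measure**: `μ(𝓕 g) = μ(𝓕)` for a
left-invariant `μ` and a countable `Γ` (Mathlib `IsFundamentalDomain.measure_eq`). [folklore] -/
theorem measure_image_mul_right_eq_of_isFundamentalDomain [SecondCountableTopology G] [SFinite μ]
    [μ.IsMulLeftInvariant] [Countable Γ] {𝓕 : Set G} (h𝓕 : IsFundamentalDomain Γ 𝓕 μ) (g : G) :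
    μ ((· * g) '' 𝓕) = μ 𝓕 :=
  (isFundamentalDomain_image_mul_right Γ μ h𝓕 g).measure_eq h𝓕

/-- **The modular function is trivial on a group with a lattice.** For a locally compact group with
an inner regular left Haar measure `μ` and a countable subgroup `Γ` with a fundamental domain `𝓕` of
finite non-zero measure, `Δ(g) = 1` for every `g`: `Δ(g⁻¹) μ(𝓕) = (map (· g⁻¹) μ)(𝓕) = μ(𝓕 g) = μ(𝓕)`.
(Raghunathan (1972), Ch. I, Remark 1.9.) [folklore] -/
theorem modularCharacterFun_eq_one_of_isFundamentalDomain [LocallyCompactSpace G]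
    [SecondCountableTopology G] [IsHaarMeasure μ] [InnerRegular μ] [Countable Γ] {𝓕 : Set G}
    (h𝓕 : IsFundamentalDomain Γ 𝓕 μ) (h0 : μ 𝓕 ≠ 0) (htop : μ 𝓕 ≠ ∞) (g : G) :
    modularCharacterFun g = 1 := by
  -- it suffices to treat `g⁻¹`, by the group structure; we prove it for all `g` directly
  suffices h : ∀ g : G, modularCharacterFun g⁻¹ = 1 by simpa using h g⁻¹
  intro g
  have hmap : Measure.map (· * g⁻¹) μ = modularCharacterFun g⁻¹ • μ :=
    map_right_mul_eq_modularCharacterFun_smul μ g⁻¹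
  -- `μ(𝓕 g) = (map (· g⁻¹) μ)(𝓕)`
  have h1 : μ ((· * g) '' 𝓕) = Measure.map (· * g⁻¹) μ 𝓕 := by
    rw [image_mul_right, (measurableEmbedding_mulRight g⁻¹).map_apply]
  have h2 : μ ((· * g) '' 𝓕) = μ 𝓕 := measure_image_mul_right_eq_of_isFundamentalDomain Γ μ h𝓕 g
  rw [h2, hmap, Measure.smul_apply] at h1
  -- `μ 𝓕 = Δ(g⁻¹) • μ 𝓕` with `0 < μ 𝓕 < ∞`
  have h3 : ((modularCharacterFun g⁻¹ : ℝ≥0) : ℝ≥0∞) * μ 𝓕 = 1 * μ 𝓕 := by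
    rw [one_mul]
    exact h1.symm
  have h4 := (ENNReal.mul_left_inj h0 htop).1 h3
  exact_mod_cast h4

/-- **A locally compact group with a finite-covolume lattice is unimodular.** Let `G` be a locally
compact second countable group with an inner regular left Haar measure `μ`, and `Γ ≤ G` a countable
subgroup with a fundamental domain `𝓕` (left multiplication) such that `0 < μ(𝓕) < ∞`. Then `μ` is
right invariant. Applied in the tree to `N_n(K) ≤ N_n(𝔸_K)` (cocompact), this discharges the
hypothesis `[IsMulRightInvariant ν]` of `WhittakerCoeffLocalDatum` (Raghunathan (1972), Ch. I,
Remark 1.9; Bekka–de la Harpe–Valette, Prop. B.2.2). [folklore] -/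
theorem isMulRightInvariant_of_isFundamentalDomain [LocallyCompactSpace G]
    [SecondCountableTopology G] [IsHaarMeasure μ] [InnerRegular μ] [Countable Γ] {𝓕 : Set G}
    (h𝓕 : IsFundamentalDomain Γ 𝓕 μ) (h0 : μ 𝓕 ≠ 0) (htop : μ 𝓕 ≠ ∞) :
    μ.IsMulRightInvariant := by
  refine ⟨fun g => ?_⟩
  rw [map_right_mul_eq_modularCharacterFun_smul μ g,
    modularCharacterFun_eq_one_of_isFundamentalDomain Γ μ h𝓕 h0 htop g, one_smul]

end Literature.NumberTheory.Automorphic
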